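/-
Copyright: the b2b-balaban cell (near-miss cell 7), T⁴-continuum fan-out; row NE7b ROUND-2 swarm, seat
t4-ne7b-formalise-leaf-05 gen 3 (row S6g′ INSTANCE of `t4/b2b-balaban-t4-ne7b-p1/LEAVES-NE7b.md`, owner's ruling
R-OWNER-22-23: T3a; finding F-leaf05g3-2).  Released under the licence of the surrounding project.
-/
import Summits.QuantumFields.BalabanUV.T4Continuum.Support.HistoryJoinsPlaced
import Summits.QuantumFields.BalabanUV.T4Continuum.Support.HistoryJoinsNonhost

/-!
# The END of the count for placements carrying region templates (row S6g′ INSTANCE, T3a — part 2 «PLACED END»)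

Summits-side support leaf of the T⁴-continuum cell (rung (B)+1 on a FINITE torus only; NOT infinite volume, NOT the
mass gap, NOT the Clay statement; NOT a proof of the spine estimate NE7b).  Row NE7b, route «COUNT», row S6g′.
[folklore] composition BY NAME of gen 2's binding (`HistoryJoinsEnd` ∕ leaf-02 gen 4's slack form
`HistoryJoinsSupEnd.card_S_le_exp_pow_slack`, the suprema `HistoryJoinsSup`), part 1's root-datum currency
(`HistoryJoinsPlaced`) and the non-host bookkeeping (`HistoryJoinsNonhost`); nothing is quoted from print, nothing
printed is asserted, no `[cite:]` tag, no `Prop` fact minted, no definition.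

WHAT.  For placements valued in `γ′ = TCell d (n·L^K) × Tm` (anchor cell, region template) with nearness `nearP`,
witness radius `radP`, local bounds by suprema (`Msup`, `extsup … radP`), root-datum count `NZP' d L lv A` and radius
factor `MρP' d A`:
* §1 `nhsum_add`, `nhsum_const_mul`; **`MρP_placed_le_exp`** — the radius-factor product under the PER-PLACEMENT radius
  law at the NON-HOST parts with an abstract potential `φ` (`radP ≤ C₀·φ + c₀`), total `Σ_{joins} nhsum φ ≤ κφ·F`:
  `MρP ≤ exp(κρ·F)`, `κρ = 2(a′ + d′c₀) + d′C₀κφ`, `a′ = a₁ + d₁`, `d′ = 2d + d₁`;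
* §2 **`card_S_le_exp_pow_placed`** — THE END: `#S zone ρ c₀ (PEv.step ∘ sh) G z ≤ exp((2 + κM + κρ + κE)·F + Ξ) ·
  (L^d·e^{μE})^{partnerAges}` under: the zone's side facts `hzoneW` (levels, scales, range — as leaf-02 gen 4's torus
  END), the template count `hA`∕`hAexp`, the per-placement cardinality law at the joins (`hlawM`, all parts, `zmass`
  currency) and radius law at the NON-HOST parts (`hlawR`, potential `φ` with class-linear total), `Dated`∕`Chrono`,
  signs, and the entropy input with slack `Ξ` (`hENT`);
* §3 the CONCRETE potential: **`hlawR_of_laws`** assembles `hlawR` with `φ t P = C₁·zmass t P + κT·(fat (root P) + 1)`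
  from a cyclic-distance law (`cdist ≤ C₁·zmass + c₁`, leaf-02 gen 4's `hlawE_of_linked` shape restricted to non-host
  parts) and a root-template law (`tsz (root template) ≤ κT·(fat (root P) + 1)` on admissibly placed non-host parts
  with a non-empty zone), and **`total_potential_le`** bounds its total by `(C₁(WB+WM)∕(1−θ) + κT)·F`
  (leaf-02 gen 3's all-parts `zmass` total + `HistoryJoinsNonhost.sum_joins_nhsum_root_le`); whence the letters-level
  END **`card_S_le_exp_pow_placed_laws`**.

HONEST SCOPE.  Composition over OUR carriers; displayed with named suppliers: `hzoneW`, `hlawM`, the two radius laws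
(T3a part 3, from leaf-04 g3's pieces law + the zone definition), `hA`∕`hAexp` (leaf-10 g4's templates), `hENT`
(`HistoryJoinsSortTwin.ENT_le_gen_sortR`), `Dated`∕`Chrono` (free on pedigrees); nothing of H3∕(B)∕BetaPertH touched;
`BirthShapeNodup` NOT retired here; NE7b NOT proved.  HONEST DEPENDENCY (cell): continuum YM on T⁴ ⇐ BetaPertH ∧ nine
spine estimates (0/9 proved); BetaPertH ⇐ (D1) ∧ (D4) ∧ CAP+tail; G-an2-4 gates asym, D1 and NE2/3/4.  This file
changes none of it.
-/

open Finset
open Literature.MathematicalPhysics.QuantumFieldTheory.Balaban1983to89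
open T4PersistenceDictionary T4PartnerMultiplicity T4BranchingRecordsGas
open Summit.QuantumFields.BalabanUV.T4Continuum.HistoryJoins
open Summit.QuantumFields.BalabanUV.T4Continuum.HistoryJoinsAdm
open Summit.QuantumFields.BalabanUV.T4Continuum.HistoryJoinsBudget
open Summit.QuantumFields.BalabanUV.T4Continuum.HistoryJoinsEntropyBudget
open Summit.QuantumFields.BalabanUV.T4Continuum.HistoryJoinsEnd
open Summit.QuantumFields.BalabanUV.T4Continuum.HistoryJoinsSup
open Summit.QuantumFields.BalabanUV.T4Continuum.HistoryJoinsSupTorus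
open Summit.QuantumFields.BalabanUV.T4Continuum.HistoryJoinsSupEnd
open Summit.QuantumFields.BalabanUV.T4Continuum.HistoryJoinsRadius
open Summit.QuantumFields.BalabanUV.T4Continuum.HistoryJoinsNonhost
open Summit.QuantumFields.BalabanUV.T4Continuum.HistoryJoinsPlaced
open Summit.QuantumFields.BalabanUV.T4Continuum.ZoneTorus
open Summit.QuantumFields.BalabanUV.T4Continuum.ZoneSkeleton
open Summit.QuantumFields.BalabanUV.T4Continuum.HistoryZones
open Summit.QuantumFields.BalabanUV.T4Continuum.HistoryZoneMass
open Summit.QuantumFields.BalabanUV.T4Continuum.HistoryMassPlacement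
open Summit.QuantumFields.BalabanUV.T4Continuum.HistoryZoneMassJoins
open Summit.QuantumFields.BalabanUV.T4Continuum.HistoryZoneMassLaw
open Summit.QuantumFields.BalabanUV.T4Continuum.HistoryZoneMassTotal

namespace Summit.QuantumFields.BalabanUV.T4Continuum.HistoryJoinsPlacedEnd

noncomputable section

open scoped Classical

/-! ## §1 Linearity of the non-host sum; the radius-factor product for placed root data -/

section Linear

variable {ε : Type*} (st : ε → ℕ)

/-- `nhsum` is additive [folklore] -/
theorem nhsum_add (g h : Gen ε → ℝ) (X : Gen ε) :
    nhsum st (fun P => g P + h P) X = nhsum st g X + nhsum st h X := by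
  cases X with
  | born b j => simp [nhsum]
  | renew G e k => simp [nhsum]
  | merge A B e => rw [nhsum_merge, nhsum_merge, nhsum_merge, sum_add_distrib]

/-- `nhsum` is homogeneous [folklore] -/
theorem nhsum_const_mul (c : ℝ) (g : Gen ε → ℝ) (X : Gen ε) :
    nhsum st (fun P => c * g P) X = c * nhsum st g X := by
  cases X with
  | born b j => simp [nhsum]
  | renew G e k => simp [nhsum]
  | merge A B e => rw [nhsum_merge, nhsum_merge, mul_sum]

end Linear

section Placed

variable {ε R Tm : Type*} [DecidableEq ε] [LinearOrder R] [Fintype Tm] {d n L K D : ℕ} (sh : ε → PEv)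
  (lv : ℕ → ℕ) (tsz : Tm → ℕ)
  (zone : ℕ → Gen ε → (Addr D → TCell d (n * L ^ K) × Tm) → Finset (Fin d → ℕ))
  (ρ : (Addr D → TCell d (n * L ^ K) × Tm) → R) (c₀ : TCell d (n * L ^ K) × Tm)

omit [DecidableEq ε] in
/-- **THE RADIUS-FACTOR PRODUCT FOR PLACED ROOT DATA**, under the per-placement radius law displayed at the NON-HOST
parts with an abstract potential of class-linear total: `MρP ≤ exp(κρ·F)`. [folklore] -/
theorem MρP_placed_le_exp {A : ℕ → ℕ} {a₁ d₁ : ℝ} (ha : 0 ≤ a₁) (hd : 0 ≤ d₁)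
    (hAexp : ∀ m : ℕ, (A m : ℝ) ≤ Real.exp (a₁ + d₁ * m))
    {C₀ c₉ : ℝ} (hC₀ : 0 ≤ C₀) (hc₉ : 0 ≤ c₉) (φ : ℕ → Gen ε → ℝ) (hφ0 : ∀ t P, 0 ≤ φ t P) (G : Gen ε)
    (hlawR : ∀ (X Y : Gen ε) (e : ε), Gen.merge X Y e ∈ joins (PEv.step ∘ sh) G →
      ∀ i, i ≠ hostIdx (PEv.step ∘ sh) X Y e →
        ∀ p ∈ Sany zone ρ c₀ (PEv.step ∘ sh) (part (PEv.step ∘ sh) (Gen.merge X Y e) i).2,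
          ∀ u ∈ zone (sh e).step (part (PEv.step ∘ sh) (Gen.merge X Y e) i).2 p,
            radP n L K lv tsz u (sh e).step (evalA c₀ p (rootAddr (part (PEv.step ∘ sh) (Gen.merge X Y e) i).2))
                (part (PEv.step ∘ sh) (Gen.merge X Y e) i).2.rootStep ≤
              C₀ * φ (sh e).step (part (PEv.step ∘ sh) (Gen.merge X Y e) i).2 + c₉)
    {κφ : ℝ}
    (hΦ : ((joins (PEv.step ∘ sh) G).map fun X => nhsum (PEv.step ∘ sh) (φ (ftime (PEv.step ∘ sh) X)) X).sum ≤
      κφ * bsum (fun b => (((sh b).fat : ℕ) : ℝ) + 1) G) :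
    MρP (PEv.step ∘ sh) (extsup zone ρ c₀ (PEv.step ∘ sh) (radP n L K lv tsz)) (MρP' d A) G ≤
      Real.exp ((2 * ((a₁ + d₁) + (2 * (d : ℝ) + d₁) * c₉) + (2 * (d : ℝ) + d₁) * C₀ * κφ) *
        bsum (fun b => (((sh b).fat : ℕ) : ℝ) + 1) G) := by
  set st := PEv.step ∘ sh
  set F := bsum (fun b => (((sh b).fat : ℕ) : ℝ) + 1) G
  have ha' : 0 ≤ a₁ + d₁ := add_nonneg ha hd
  have hd' : 0 ≤ 2 * (d : ℝ) + d₁ := by positivity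
  have h := MρP_le_exp_of_nonhost_law st (extsup zone ρ c₀ st (radP n L K lv tsz)) (MρP' d A) ha' hd'
    (fun r => MρP'_nonneg A r) (fun r hr => MρP'_le_exp (d := d) hd hAexp hr)
    (fun t P => extsup_nonneg zone ρ c₀ st _ t P) hC₀ hc₉ φ G
    (fun X Y e hX i hi => extsup_le_of_forall zone ρ c₀ st (radP n L K lv tsz)
      (add_nonneg (mul_nonneg hC₀ (hφ0 _ _)) hc₉) (hlawR X Y e hX i hi)) le_rfl
  refine h.trans (Real.exp_le_exp.2 ?_)
  have hn : (nmerges G : ℝ) + 1 ≤ F := nmerges_lt_bsum sh G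
  have hn0 : (0 : ℝ) ≤ nmerges G := Nat.cast_nonneg _
  have hac : 0 ≤ (a₁ + d₁) + (2 * (d : ℝ) + d₁) * c₉ := by positivity
  have hdC : 0 ≤ (2 * (d : ℝ) + d₁) * C₀ := by positivity
  have h1 : ((a₁ + d₁) + (2 * (d : ℝ) + d₁) * c₉) * (2 * (nmerges G : ℝ)) ≤
      2 * ((a₁ + d₁) + (2 * (d : ℝ) + d₁) * c₉) * F := by nlinarith
  have h2 : (2 * (d : ℝ) + d₁) * C₀ *
      ((joins st G).map fun X => nhsum st (φ (ftime st X)) X).sum ≤ (2 * (d : ℝ) + d₁) * C₀ * κφ * F := by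
    have := mul_le_mul_of_nonneg_left hΦ hdC
    linarith [this]
  linarith

/-! ## §2 The END for placed root data -/

/-- **ROW S6g′ INSTANCE — THE COUNT's END FOR PLACEMENTS CARRYING REGION TEMPLATES.**  For every shape tree `G` read by
`st := PEv.step ∘ sh` and root datum `z`:
`#S zone ρ c₀ st G z ≤ exp((2 + κM + κρ + κE)·F + Ξ)·(L^d·e^{μE})^{partnerAges st G}`,
`κM = (WB+WM)∕(1−θ) + 2γ′`, `κρ = 2(a₁ + d₁ + (2d+d₁)c₀) + (2d+d₁)·C₀·κφ`. [folklore] -/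
theorem card_S_le_exp_pow_placed (hL : 1 ≤ L) (hlv : HistoryZones.LevelFn K lv)
    (hzoneW : ∀ (t : ℕ) (Z : Gen ε) (p : Addr D → TCell d (n * L ^ K) × Tm) (u : Fin d → ℕ),
      p ∈ Sany zone ρ c₀ (PEv.step ∘ sh) Z → u ∈ zone t Z p →
        lv t ≤ K ∧ IsScale L (lv Z.rootStep) (evalA c₀ p (rootAddr Z)).1 ∧ ∀ i, u i < n * L ^ (K - lv t))
    {A : ℕ → ℕ} (hA : ∀ m : ℕ, ((univ : Finset Tm).filter fun T => tsz T ≤ m).card ≤ A m)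
    {a₁ d₁ : ℝ} (ha : 0 ≤ a₁) (hd : 0 ≤ d₁) (hAexp : ∀ m : ℕ, (A m : ℝ) ≤ Real.exp (a₁ + d₁ * m))
    {θ WB WM γ' C₀ c₉ κφ : ℝ} (hθ0 : 0 ≤ θ) (hθ1 : θ < 1) (hB : 0 ≤ WB) (hM : 0 ≤ WM) (hγ : 0 ≤ γ')
    (hC₀ : 0 ≤ C₀) (hc₉ : 0 ≤ c₉)
    {G : Gen ε} {T : ℕ} (hDt : Dated (PEv.step ∘ sh) true T G) (hCh : Chrono (PEv.step ∘ sh) G)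
    (hlawM : ∀ X ∈ joins (PEv.step ∘ sh) G, ∀ P ∈ tparts (PEv.step ∘ sh) X,
      ∀ p ∈ Sany zone ρ c₀ (PEv.step ∘ sh) P,
        ((zone (ftime (PEv.step ∘ sh) X) P p).card : ℝ) ≤ zmass sh θ WB WM (ftime (PEv.step ∘ sh) X) P + γ')
    (φ : ℕ → Gen ε → ℝ) (hφ0 : ∀ t P, 0 ≤ φ t P)
    (hlawR : ∀ (X Y : Gen ε) (e : ε), Gen.merge X Y e ∈ joins (PEv.step ∘ sh) G →
      ∀ i, i ≠ hostIdx (PEv.step ∘ sh) X Y e →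
        ∀ p ∈ Sany zone ρ c₀ (PEv.step ∘ sh) (part (PEv.step ∘ sh) (Gen.merge X Y e) i).2,
          ∀ u ∈ zone (sh e).step (part (PEv.step ∘ sh) (Gen.merge X Y e) i).2 p,
            radP n L K lv tsz u (sh e).step (evalA c₀ p (rootAddr (part (PEv.step ∘ sh) (Gen.merge X Y e) i).2))
                (part (PEv.step ∘ sh) (Gen.merge X Y e) i).2.rootStep ≤
              C₀ * φ (sh e).step (part (PEv.step ∘ sh) (Gen.merge X Y e) i).2 + c₉)
    (hΦ : ((joins (PEv.step ∘ sh) G).map fun X => nhsum (PEv.step ∘ sh) (φ (ftime (PEv.step ∘ sh) X)) X).sum ≤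
      κφ * bsum (fun b => (((sh b).fat : ℕ) : ℝ) + 1) G)
    {κE μE Ξ : ℝ}
    (hENT : ENT (PEv.step ∘ sh) G ≤
      κE * bsum (fun b => (((sh b).fat : ℕ) : ℝ) + 1) G + μE * partnerAges (PEv.step ∘ sh) G + Ξ)
    (z : TCell d (n * L ^ K) × Tm) :
    ((S zone ρ c₀ (PEv.step ∘ sh) G z).card : ℝ) ≤
      Real.exp ((2 + ((WB + WM) / (1 - θ) + 2 * γ') +
          (2 * ((a₁ + d₁) + (2 * (d : ℝ) + d₁) * c₉) + (2 * (d : ℝ) + d₁) * C₀ * κφ) + κE) *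
          bsum (fun b => (((sh b).fat : ℕ) : ℝ) + 1) G + Ξ) *
        (((L : ℝ) ^ d) * Real.exp μE) ^ partnerAges (PEv.step ∘ sh) G :=
  card_S_le_exp_pow_slack (PEv.step ∘ sh) (Msup zone ρ c₀ (PEv.step ∘ sh))
    (extsup zone ρ c₀ (PEv.step ∘ sh) (radP n L K lv tsz)) (NZP' d L lv A) (MρP' d A) zone ρ c₀
    (nearP n L K lv tsz) (fun t Z _ hp => card_zone_le_Msup zone ρ c₀ (PEv.step ∘ sh) t Z hp)
    (fun t Z p u hp hu => near_extsup zone ρ c₀ (PEv.step ∘ sh) (radP n L K lv tsz) (nearP n L K lv tsz)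
      (nearP_mono n L K lv tsz) (fun t Z p u hp hu => by
        obtain ⟨htK, hsc, hrange⟩ := hzoneW t Z p u hp hu
        exact nearP_of_scale n L K lv tsz htK hsc hrange) t Z p u hp hu)
    (fun u t s r => card_nearP_le n L K lv tsz hL hA u t s r) (by positivity) (fun r => MρP'_nonneg A r)
    (fun r t s => NZP'_le hlv hL A r t s) (fun b => (sh b).fat) G
    (MS_sup_le_bsum zone ρ c₀ sh hθ0 hθ1 hB hM hγ hDt hCh hlawM)
    (MρP_placed_le_exp sh lv tsz zone ρ c₀ ha hd hAexp hC₀ hc₉ φ hφ0 G hlawR hΦ) hENT z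

/-! ## §3 The concrete potential: cyclic-distance law × root-template law -/

omit [DecidableEq ε] in
/-- **THE RADIUS LAW FROM TWO READING LAWS** at the non-host parts: a cyclic-distance law
`cdist (u, root block) ≤ C₁·zmass + c₁` and a root-template law `tsz (root template) ≤ κT·(fat (root) + 1)` give
`radP ≤ 1·(C₁·zmass + κT·(fat root + 1)) + c₁`. [folklore] -/
theorem hlawR_of_laws {G : Gen ε} {θ WB WM C₁ c₁ κT : ℝ}
    (hlawC : ∀ (X Y : Gen ε) (e : ε), Gen.merge X Y e ∈ joins (PEv.step ∘ sh) G →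
      ∀ i, i ≠ hostIdx (PEv.step ∘ sh) X Y e →
        ∀ p ∈ Sany zone ρ c₀ (PEv.step ∘ sh) (part (PEv.step ∘ sh) (Gen.merge X Y e) i).2,
          ∀ u ∈ zone (sh e).step (part (PEv.step ∘ sh) (Gen.merge X Y e) i).2 p,
            ((cdist (n * L ^ (K - lv (sh e).step)) u
                (blk L (lv (sh e).step) (evalA c₀ p (rootAddr (part (PEv.step ∘ sh) (Gen.merge X Y e) i).2)).1) : ℕ) : ℝ) ≤
              C₁ * zmass sh θ WB WM (sh e).step (part (PEv.step ∘ sh) (Gen.merge X Y e) i).2 + c₁)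
    (hlawT : ∀ (X Y : Gen ε) (e : ε), Gen.merge X Y e ∈ joins (PEv.step ∘ sh) G →
      ∀ i, i ≠ hostIdx (PEv.step ∘ sh) X Y e →
        ∀ p ∈ Sany zone ρ c₀ (PEv.step ∘ sh) (part (PEv.step ∘ sh) (Gen.merge X Y e) i).2,
          (zone (sh e).step (part (PEv.step ∘ sh) (Gen.merge X Y e) i).2 p).Nonempty →
            (tsz (evalA c₀ p (rootAddr (part (PEv.step ∘ sh) (Gen.merge X Y e) i).2)).2 : ℝ) ≤
              κT * ((((sh (part (PEv.step ∘ sh) (Gen.merge X Y e) i).2.root).fat : ℕ) : ℝ) + 1)) :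
    ∀ (X Y : Gen ε) (e : ε), Gen.merge X Y e ∈ joins (PEv.step ∘ sh) G →
      ∀ i, i ≠ hostIdx (PEv.step ∘ sh) X Y e →
        ∀ p ∈ Sany zone ρ c₀ (PEv.step ∘ sh) (part (PEv.step ∘ sh) (Gen.merge X Y e) i).2,
          ∀ u ∈ zone (sh e).step (part (PEv.step ∘ sh) (Gen.merge X Y e) i).2 p,
            radP n L K lv tsz u (sh e).step (evalA c₀ p (rootAddr (part (PEv.step ∘ sh) (Gen.merge X Y e) i).2))
                (part (PEv.step ∘ sh) (Gen.merge X Y e) i).2.rootStep ≤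
              1 * (C₁ * zmass sh θ WB WM (sh e).step (part (PEv.step ∘ sh) (Gen.merge X Y e) i).2 +
                κT * ((((sh (part (PEv.step ∘ sh) (Gen.merge X Y e) i).2.root).fat : ℕ) : ℝ) + 1)) + c₁ := by
  intro X Y e hX i hi p hp u hu
  have h1 := hlawC X Y e hX i hi p hp u hu
  have h2 := hlawT X Y e hX i hi p hp ⟨u, hu⟩
  have hT0 : (0 : ℝ) ≤ κT * ((((sh (part (PEv.step ∘ sh) (Gen.merge X Y e) i).2.root).fat : ℕ) : ℝ) + 1) :=
    le_trans (Nat.cast_nonneg _) h2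
  have hZ0 : (0 : ℝ) ≤ C₁ * zmass sh θ WB WM (sh e).step (part (PEv.step ∘ sh) (Gen.merge X Y e) i).2 + c₁ :=
    le_trans (Nat.cast_nonneg _) h1
  rw [radP_apply]
  refine max_le ?_ ?_ <;> linarith

/-- **THE TOTAL OF THE CONCRETE POTENTIAL** `φ t P = C₁·zmass t P + κT·(fat (root P) + 1)` over the NON-HOST parts:
`≤ (C₁·(WB+WM)∕(1−θ) + κT)·F` (the `zmass` total over ALL parts, leaf-02 gen 3; the root-fatness total over the non-host
parts = the non-root births, `HistoryJoinsNonhost`). [folklore] -/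
theorem total_potential_le {G : Gen ε} {T : ℕ} {θ WB WM C₁ κT : ℝ} (hθ0 : 0 ≤ θ) (hθ1 : θ < 1) (hB : 0 ≤ WB)
    (hM : 0 ≤ WM) (hC₁ : 0 ≤ C₁) (hκT : 0 ≤ κT) (hDt : Dated (PEv.step ∘ sh) true T G) (hCh : Chrono (PEv.step ∘ sh) G) :
    ((joins (PEv.step ∘ sh) G).map fun X => nhsum (PEv.step ∘ sh)
        (fun P => C₁ * zmass sh θ WB WM (ftime (PEv.step ∘ sh) X) P +
          κT * ((((sh P.root).fat : ℕ) : ℝ) + 1)) X).sum ≤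
      (C₁ * ((WB + WM) / (1 - θ)) + κT) * bsum (fun b => (((sh b).fat : ℕ) : ℝ) + 1) G := by
  set st := PEv.step ∘ sh
  set F := bsum (fun b => (((sh b).fat : ℕ) : ℝ) + 1) G
  -- split the potential
  have hsplit : ((joins st G).map fun X => nhsum st
        (fun P => C₁ * zmass sh θ WB WM (ftime st X) P + κT * ((((sh P.root).fat : ℕ) : ℝ) + 1)) X).sum =
      C₁ * ((joins st G).map fun X => nhsum st (fun P => zmass sh θ WB WM (ftime st X) P) X).sum +
        κT * ((joins st G).map (nhsum st fun P => (((sh P.root).fat : ℕ) : ℝ) + 1)).sum := by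
    rw [← List.sum_map_mul_left, ← List.sum_map_mul_left, ← List.sum_map_add]
    refine congrArg List.sum (List.map_congr_left fun X _ => ?_)
    rw [nhsum_add, nhsum_const_mul, nhsum_const_mul]
  rw [hsplit]
  -- the mass part: non-host ≤ all parts ≤ umass∕(1−θ) ≤ (WB+WM)∕(1−θ)·F
  have hmass : ((joins st G).map fun X => nhsum st (fun P => zmass sh θ WB WM (ftime st X) P) X).sum ≤
      (WB + WM) / (1 - θ) * F := by
    have h1 : ((joins st G).map fun X => nhsum st (fun P => zmass sh θ WB WM (ftime st X) P) X).sum ≤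
        ((joins st G).map fun X => ((tparts st X).map fun P => zmass sh θ WB WM (ftime st X) P).sum).sum :=
      List.sum_le_sum fun X _ => nhsum_le_sum_tparts st (fun P => zmass_nonneg (sh := sh) hθ0 hB hM _ P) X
    have h2 := sum_joins_tparts_zmass_le hθ0 hθ1 hB hM hDt hCh
    have hn : (nmerges G : ℝ) + 1 ≤ F := nmerges_lt_bsum sh G
    have hn0 : (0 : ℝ) ≤ nmerges G := Nat.cast_nonneg _
    have hu : umass sh WB WM G = WB * F + WM * (nmerges G : ℝ) := by rw [umass_eq_bsum, ← bsum_mul]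
    have h1θ : 0 < 1 - θ := by linarith
    have h3 : umass sh WB WM G ≤ (WB + WM) * F := by rw [hu]; nlinarith
    have h4 : umass sh WB WM G / (1 - θ) ≤ (WB + WM) / (1 - θ) * F := by
      rw [div_mul_eq_mul_div]; exact div_le_div_of_nonneg_right h3 h1θ.le
    exact h1.trans (h2.trans h4)
  -- the root-fatness part: the non-host roots are the non-root births
  have hfat : ((joins st G).map (nhsum st fun P => (((sh P.root).fat : ℕ) : ℝ) + 1)).sum ≤ F :=
    sum_joins_nhsum_root_le st (g := fun b => (((sh b).fat : ℕ) : ℝ) + 1) (fun b => by positivity) G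
  have hF0 : 0 ≤ F := bsum_nonneg (fun b => by positivity) G
  nlinarith [mul_le_mul_of_nonneg_left hmass hC₁, mul_le_mul_of_nonneg_left hfat hκT]

end Placed

end

end Summit.QuantumFields.BalabanUV.T4Continuum.HistoryJoinsPlacedEnd
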